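import Summits.ResolutionOfSingularities.ResolutionOfSingularities.Theses.RisoStrata
import Literature.AlgebraicGeometry.Resolution.RegularLocalRingsNormal
import Literature.AlgebraicGeometry.Resolution.InseparableLocalUniformizationDefect

/-!
# Crux `RisoCentresResolve` (stmt-ResolutionOfSingularities-18546) — the blow-up tower is load-bearing:
# the existential `∃ sched` cannot be witnessed by the empty schedule

Route `ResolutionOfSingularities/RisoStrata`, crux `RisoCentresResolve`.  The crux asks for ONE finite
schedule of riso-cut blow-ups after which every valuative local ring of every chart is regular.
`risoCentresResolve_false_without_blowups` proves that the crux with `∃ sched : List ℕ,` replaced by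
`let sched : List ℕ := [];` (everything else VERBATIM — all `let`s kept; the tower `stage B₀ [] x 0` is
then the starting chart `B₀` itself and the admissibility hypotheses are vacuous) is FALSE: the conclusion
shape `IsRegularLocalRing ↥(loc O B₀)` genuinely fails on a singular presentation, so any proof of the
crux must produce a non-empty schedule for some presentation (no vacuity / no "already regular" escape).

Witness: `p = 2`, `k = 𝔽₂^alg`, `K = k(X)`, `N = 2`, `h = (1, X², X³)` (the cuspidal cubic: ratios
`hᵢ/hⱼ` generate `k(X)` since `X = X³/X²`), chart `j = 0` with `B₀ = k[1, X², X³]`, and `O` = the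
`X`-adic valuation ring of `k(X)` (`Polynomial.idealX`).  Then `loc O B₀ = k[X², X³]_{(X²,X³)}` is not
regular: a regular local ring is integrally closed (tree theorem
`isIntegrallyClosed_of_isRegularLocalRing`, Matsumura 19.4), but `z = X³/X²` in its fraction field
satisfies `z² = X²`, so it would lie in the ring, i.e. `X ∈ loc O B₀`; yet every element of `loc O B₀` is
`f/g` with `f, g ∈ k[X]`, `f'(0) = g'(0) = 0`, `g(0) ≠ 0`, and `X·g = f` forces `g(0) = (Xg)'(0) = f'(0) = 0`.
No definitions (the variant statement is displayed inline); kernel-only (propext, choice, Quot.sound).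
-/

set_option linter.dupNamespace false

namespace Summit.ResolutionOfSingularities.ResolutionOfSingularities.Theorems

open Polynomial

section Helpers

variable {k : Type} [Field k]

/-- Leibniz rule for the functional `f ↦ f'(0)` (the coefficient of `X`). [folklore] -/
theorem nilSchedD_mul (f g : k[X]) : (derivative (f * g)).coeff 0 =
    (derivative f).coeff 0 * g.coeff 0 + f.coeff 0 * (derivative g).coeff 0 := by
  simp [derivative_mul, mul_coeff_zero]

/-- `(Xⁿ)'(0) = 0` for `n ≥ 2`. [folklore] -/
theorem nilSchedD_X_pow (n : ℕ) (hn : 2 ≤ n) : (derivative ((X : k[X]) ^ n)).coeff 0 = 0 := by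
  obtain ⟨m, rfl⟩ := Nat.exists_eq_add_of_le hn
  simp [derivative_X_pow, coeff_X_pow]
  intro h; omega

/-- `(X·g)'(0) = g(0)`. [folklore] -/
theorem nilSchedD_X_mul (g : k[X]) : (derivative (X * g)).coeff 0 = g.coeff 0 := by
  simp [derivative_mul, mul_coeff_zero]

end Helpers

/-- **The blow-up tower is load-bearing in `RisoCentresResolve`.** The displayed statement is the crux
`RisoStrata.RisoCentresResolve` with its existential `∃ sched : List ℕ,` replaced by the fixed empty
schedule `let sched : List ℕ := [];`, everything else verbatim (no blow-up is performed: "every valuative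
local ring of every starting chart is already regular"); it is FALSE — for the cuspidal presentation
`h = (1, X², X³)` of `k(X)` (`k = 𝔽₂^alg`), the local ring of the chart `k[X², X³]` at the `X`-adic
valuation is not regular (not integrally closed: `(X³/X²)² = X²`). [folklore] -/
theorem risoCentresResolve_false_without_blowups : ¬ (∀ p : ℕ, p.Prime → ∀ (k : Type) [Field k] [CharP k p] [IsAlgClosed k] (K : Type) [Field K] [Algebra k K] (N : ℕ) (h : Fin (N + 1) → K), (∀ i, h i ≠ 0) → IntermediateField.adjoin k (Set.range fun ij : Fin (N + 1) × Fin (N + 1) => h ij.1 * (h ij.2)⁻¹) = ⊤ → let Arc : ∀ (B : Subalgebra k K), Ideal ↥B → Type := fun B m => {α : ↥B →ₐ[k] HahnSeries ℚ k // ∀ b ∈ m, 0 < (α b).orderTop}; let Rtd : ∀ (B : Subalgebra k K), Ideal ↥B → ℕ → Prop := fun B m r => ∃ (n : ℕ) (g : Fin n → ↥B), (∀ i, g i ∈ m) ∧ Algebra.adjoin k (Set.range fun i => (g i : K)) = B ∧ ∃ W : Submodule k (Fin n → k), r ≤ Module.finrank k ↥W ∧ ∃ φ : Arc B m → (Fin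 n → HahnSeries ℚ k), (∀ a b : Arc B m, a ≠ b → ∃ j, ∀ i, (a.1 (g j) - b.1 (g j)).orderTop < ((φ a i - φ b i) - (a.1 (g i) - b.1 (g i))).orderTop) ∧ (∀ a i, 0 < (φ a i).orderTop) ∧ (∀ a, ∀ w : Fin n → HahnSeries ℚ k, (∀ i, 0 < (w i).orderTop) → w ∈ Submodule.span (HahnSeries ℚ k) ((fun u : Fin n → k => fun i => HahnSeries.C (u i)) '' (W : Set (Fin n → k))) → ∃ b, φ b = φ a + w); let Cen : ∀ (B : Subalgebra k K), ℕ → Ideal ↥B := fun B d => ⨅ m ∈ {m : Ideal ↥B | ∃ hm : m.IsMaximal, ¬ IsRegularLocalRing (Localization (@Ideal.primeCompl ↥B _ m hm.isPrime)) ∧ ¬ Rtd B m (d + 1)}, m; let step : Subalgebra k K → ℕ → K → Subalgebra k K := fun B d xt => Algebra.adjoin k ((B : Set K) ∪ {y | ∃ a ∈ Cen B d, y = (a : K) * xt⁻¹}); let Valid : ValuationSubring K → Subalgebra k K → ℕ → K → Prop := fun O B d xt => xt ≠ 0 ∧ (∃ x ∈ Cen B d, (x : K) = xt) ∧ ∀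 a' ∈ Cen B d, (a' : K) * xt⁻¹ ∈ O; let stage : Subalgebra k K → List ℕ → (ℕ → K) → ℕ → Subalgebra k K := fun B₀ sched x t => ((sched.take t).zipIdx).foldl (fun B de => step B de.1 (x de.2)) B₀; let loc : ValuationSubring K → Subalgebra k K → Subalgebra k K := fun O B => Algebra.adjoin k {y | ∃ a ∈ B, ∃ s ∈ B, s⁻¹ ∈ O ∧ y = a * s⁻¹}; let sched : List ℕ := []; ∀ O : ValuationSubring K, (∀ c : k, algebraMap k K c ∈ O) → ∀ j : Fin (N + 1), (∀ i, h i * (h j)⁻¹ ∈ O) → ∀ x : ℕ → K, (∀ t, t < sched.length → Valid O (stage (Algebra.adjoin k (Set.range fun i => h i * (h j)⁻¹)) sched x t) (sched.getD t 0) (x t)) → IsRegularLocalRing ↥(loc O (stage (Algebra.adjoin k (Set.range fun i => h i * (h j)⁻¹)) sched x sched.length))) := by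
  intro H
  let k : Type := AlgebraicClosure (ZMod 2)
  let K : Type := RatFunc k
  let T : K := RatFunc.X
  let h : Fin (2 + 1) → K := ![1, T ^ 2, T ^ 3]
  have hT0 : T ≠ 0 := RatFunc.X_ne_zero
  have hh0 : ∀ i, h i ≠ 0 := by
    intro i
    fin_cases i
    · exact one_ne_zero
    · exact pow_ne_zero 2 hT0
    · exact pow_ne_zero 3 hT0
  -- the ratios generate `k(X)`: `X = X³ · (X²)⁻¹`
  have hgen : IntermediateField.adjoin k
      (Set.range fun ij : Fin (2 + 1) × Fin (2 + 1) => h ij.1 * (h ij.2)⁻¹) = ⊤ := by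
    rw [eq_top_iff, ← Literature.AlgebraicGeometry.Resolution.ratFunc_adjoin_X_eq_top k]
    refine IntermediateField.adjoin_le_iff.mpr ?_
    rintro _ rfl
    refine IntermediateField.subset_adjoin k _ ⟨((2 : Fin 3), (1 : Fin 3)), ?_⟩
    change T ^ 3 * (T ^ 2)⁻¹ = T
    rw [pow_succ, mul_comm (T ^ 2) T, mul_inv_cancel_right₀ (pow_ne_zero 2 hT0)]
  -- the `X`-adic valuation ring
  let v := (Polynomial.idealX k).valuation K
  let O : ValuationSubring K := v.valuationSubring
  have hOpoly : ∀ r : k[X], algebraMap k[X] K r ∈ O := fun r =>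
    (Valuation.mem_valuationSubring_iff v _).mpr (IsDedekindDomain.HeightOneSpectrum.valuation_le_one _ r)
  have hOk : ∀ c : k, algebraMap k K c ∈ O := by
    intro c
    rw [IsScalarTower.algebraMap_apply k k[X] K]
    exact hOpoly _
  have hT : T = algebraMap k[X] K Polynomial.X := (RatFunc.algebraMap_X).symm
  have hchart : ∀ i, h i * (h 0)⁻¹ ∈ O := by
    intro i
    have h0 : h 0 = 1 := rfl
    rw [h0, inv_one, mul_one]
    fin_cases i
    · exact one_mem O
    · change T ^ 2 ∈ O
      rw [hT, ← map_pow]; exact hOpoly _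
    · change T ^ 3 ∈ O
      rw [hT, ← map_pow]; exact hOpoly _
  have HH := H 2 Nat.prime_two k K 2 h hh0 hgen
  dsimp only at HH
  have hreg := HH O hOk 0 hchart (fun _ => 0) (fun t ht => absurd ht (Nat.not_lt_zero t))
  clear HH H
  -- the local ring in question
  set B₀ : Subalgebra k K := Algebra.adjoin k (Set.range fun i => h i * (h 0)⁻¹) with hB₀
  set L : Subalgebra k K :=
    Algebra.adjoin k {y | ∃ a ∈ B₀, ∃ s ∈ B₀, s⁻¹ ∈ O ∧ y = a * s⁻¹} with hL
  change IsRegularLocalRing ↥L at hreg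
  -- (1) `B₀ ≤ L` and `X², X³ ∈ B₀`
  have hB₀L : B₀ ≤ L := by
    intro y hy
    refine Algebra.subset_adjoin ⟨y, hy, 1, one_mem B₀, ?_, ?_⟩
    · rw [inv_one]; exact one_mem O
    · rw [inv_one, mul_one]
  have hT2 : T ^ 2 ∈ B₀ := Algebra.subset_adjoin ⟨1, by
    change T ^ 2 * (1 : K)⁻¹ = T ^ 2
    rw [inv_one, mul_one]⟩
  have hT3 : T ^ 3 ∈ B₀ := Algebra.subset_adjoin ⟨2, by
    change T ^ 3 * (1 : K)⁻¹ = T ^ 3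
    rw [inv_one, mul_one]⟩
  -- (2) `X ∉ L`: `L` sits inside the subalgebra `M` of fractions `f/g`, `f'(0)=g'(0)=0 ≠ g(0)`
  have hB₀M : ∀ a ∈ B₀, ∃ f : k[X], (derivative f).coeff 0 = 0 ∧ a = algebraMap k[X] K f := by
    intro a ha
    -- the subalgebra of polynomials `f` with `f'(0) = 0`
    let M₁ : Subalgebra k K :=
      { carrier := {a | ∃ f : k[X], (derivative f).coeff 0 = 0 ∧ a = algebraMap k[X] K f}
        mul_mem' := by
          rintro _ _ ⟨f, hf, rfl⟩ ⟨g, hg, rfl⟩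
          exact ⟨f * g, by rw [nilSchedD_mul, hf, hg]; ring, (map_mul _ _ _).symm⟩
        add_mem' := by
          rintro _ _ ⟨f, hf, rfl⟩ ⟨g, hg, rfl⟩
          refine ⟨f + g, ?_, (map_add _ _ _).symm⟩
          rw [derivative_add, coeff_add, hf, hg, add_zero]
        algebraMap_mem' := fun c => ⟨C c, by simp, by
          rw [IsScalarTower.algebraMap_apply k k[X] K, Polynomial.algebraMap_eq]⟩ }
    have hle : B₀ ≤ M₁ := by
      rw [hB₀]
      refine Algebra.adjoin_le ?_
      rintro _ ⟨i, rfl⟩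
      have h0 : h 0 = 1 := rfl
      change h i * (h 0)⁻¹ ∈ M₁
      rw [h0, inv_one, mul_one]
      fin_cases i
      · exact one_mem M₁
      · exact ⟨X ^ 2, nilSchedD_X_pow 2 le_rfl, by change T ^ 2 = _; rw [map_pow, ← hT]⟩
      · exact ⟨X ^ 3, nilSchedD_X_pow 3 (by norm_num), by change T ^ 3 = _; rw [map_pow, ← hT]⟩
    exact hle ha
  -- the subalgebra of fractions `f/g` with `f'(0) = g'(0) = 0 ≠ g(0)`: contains `L`, not `X`
  let M : Subalgebra k K :=
    { carrier := {y | ∃ f g : k[X], (derivative f).coeff 0 = 0 ∧ (derivative g).coeff 0 = 0 ∧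
        g.coeff 0 ≠ 0 ∧ y = algebraMap k[X] K f / algebraMap k[X] K g}
      mul_mem' := by
        rintro _ _ ⟨f₁, g₁, hf₁, hg₁, hg₁0, rfl⟩ ⟨f₂, g₂, hf₂, hg₂, hg₂0, rfl⟩
        refine ⟨f₁ * f₂, g₁ * g₂, ?_, ?_, ?_, ?_⟩
        · rw [nilSchedD_mul, hf₁, hf₂]; ring
        · rw [nilSchedD_mul, hg₁, hg₂]; ring
        · rw [mul_coeff_zero]; exact mul_ne_zero hg₁0 hg₂0
        · rw [map_mul, map_mul, div_mul_div_comm]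
      add_mem' := by
        rintro _ _ ⟨f₁, g₁, hf₁, hg₁, hg₁0, rfl⟩ ⟨f₂, g₂, hf₂, hg₂, hg₂0, rfl⟩
        have h1 : algebraMap k[X] K g₁ ≠ 0 :=
          (map_ne_zero_iff _ (IsFractionRing.injective k[X] K)).mpr
            (fun h => hg₁0 (by rw [h, coeff_zero]))
        have h2 : algebraMap k[X] K g₂ ≠ 0 :=
          (map_ne_zero_iff _ (IsFractionRing.injective k[X] K)).mpr
            (fun h => hg₂0 (by rw [h, coeff_zero]))
        refine ⟨f₁ * g₂ + g₁ * f₂, g₁ * g₂, ?_, ?_, ?_, ?_⟩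
        · rw [derivative_add, coeff_add, nilSchedD_mul, nilSchedD_mul, hf₁, hg₁, hf₂, hg₂]; ring
        · rw [nilSchedD_mul, hg₁, hg₂]; ring
        · rw [mul_coeff_zero]; exact mul_ne_zero hg₁0 hg₂0
        · rw [map_add, map_mul, map_mul, map_mul, div_add_div _ _ h1 h2]
      algebraMap_mem' := by
        intro c
        refine ⟨C c, 1, by simp, by simp, by simp, ?_⟩
        rw [map_one, div_one, IsScalarTower.algebraMap_apply k k[X] K, Polynomial.algebraMap_eq] }
  have hXM : T ∉ M := by
    rintro ⟨f, g, hf, -, hg0, hX⟩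
    have hg : algebraMap k[X] K g ≠ 0 :=
      (map_ne_zero_iff _ (IsFractionRing.injective k[X] K)).mpr (fun h => hg0 (by rw [h, coeff_zero]))
    have hXg : algebraMap k[X] K (X * g) = algebraMap k[X] K f := by
      rw [map_mul, ← hT, hX, div_mul_cancel₀ _ hg]
    have := congrArg (fun q : k[X] => (derivative q).coeff 0) (IsFractionRing.injective k[X] K hXg)
    simp only [nilSchedD_X_mul, hf] at this
    exact hg0 this
  have hLM : L ≤ M := by
    rw [hL]
    refine Algebra.adjoin_le ?_
    rintro _ ⟨a, ha, s, hs, hsO, rfl⟩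
    obtain ⟨f, hf, rfl⟩ := hB₀M a ha
    obtain ⟨g, hg, rfl⟩ := hB₀M s hs
    by_cases hg0 : g = 0
    · rw [hg0, map_zero, inv_zero, mul_zero]; exact zero_mem _
    have hgK : algebraMap k[X] K g ≠ 0 :=
      (map_ne_zero_iff _ (IsFractionRing.injective k[X] K)).mpr hg0
    -- `g⁻¹ ∈ O` forces `v g = 1`, i.e. `X ∤ g`, i.e. `g(0) ≠ 0`
    have hv1 : v (algebraMap k[X] K g) = 1 := by
      have hle1 : v (algebraMap k[X] K g) ≤ 1 :=
        IsDedekindDomain.HeightOneSpectrum.valuation_le_one _ g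
      have hinv : (v (algebraMap k[X] K g))⁻¹ ≤ 1 := by
        rw [← map_inv₀]; exact (Valuation.mem_valuationSubring_iff v _).mp hsO
      have hne : v (algebraMap k[X] K g) ≠ 0 := (Valuation.ne_zero_iff v).mpr hgK
      exact le_antisymm hle1 (by rwa [inv_le_one₀ (zero_lt_iff.mpr hne)] at hinv)
    have hcoeff : g.coeff 0 ≠ 0 := by
      have hnot : g ∉ (Polynomial.idealX k).asIdeal :=
        (IsDedekindDomain.HeightOneSpectrum.valuation_eq_one_iff_notMem (K := K)
          (Polynomial.idealX k)).mp hv1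
      rw [Polynomial.idealX_span, Ideal.mem_span_singleton, Polynomial.X_dvd_iff] at hnot
      exact hnot
    exact ⟨f, g, hf, hg, hcoeff, by rw [div_eq_mul_inv]⟩
  have hXL : T ∉ L := fun hx => hXM (hLM hx)
  -- (3) regular ⇒ integrally closed ⇒ `X = X³/X² ∈ L`
  haveI : IsRegularLocalRing ↥L := hreg
  have hic : IsIntegrallyClosed ↥L :=
    Literature.AlgebraicGeometry.Resolution.isIntegrallyClosed_of_isRegularLocalRing ↥L
  let a₂ : ↥L := ⟨T ^ 2, hB₀L hT2⟩
  let a₃ : ↥L := ⟨T ^ 3, hB₀L hT3⟩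
  have ha₂0 : a₂ ≠ 0 := by
    intro h0
    have : (a₂ : K) = 0 := by rw [h0]; rfl
    exact pow_ne_zero 2 hT0 this
  have hrel : a₃ ^ 2 = a₂ ^ 3 := by
    apply Subtype.ext
    change (T ^ 3) ^ 2 = (T ^ 2) ^ 3
    ring
  let F := FractionRing ↥L
  have ha₂F : algebraMap (↥L) F a₂ ≠ 0 :=
    (map_ne_zero_iff _ (IsFractionRing.injective (↥L) F)).mpr ha₂0
  let z : F := algebraMap (↥L) F a₃ / algebraMap (↥L) F a₂
  have hz2 : z ^ 2 = algebraMap (↥L) F a₂ := by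
    change (algebraMap (↥L) F a₃ / algebraMap (↥L) F a₂) ^ 2 = _
    rw [div_pow, ← map_pow, hrel, map_pow, pow_succ, mul_div_cancel_left₀ _ (pow_ne_zero 2 ha₂F)]
  have hzint : IsIntegral (↥L) z := by
    refine ⟨Polynomial.X ^ 2 - Polynomial.C a₂, Polynomial.monic_X_pow_sub_C a₂ two_ne_zero, ?_⟩
    simp [hz2]
  obtain ⟨y, hy⟩ := IsIntegrallyClosed.algebraMap_eq_of_integral hzint
  have hya : y * a₂ = a₃ := by
    apply IsFractionRing.injective (↥L) F
    rw [map_mul, hy]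
    change algebraMap (↥L) F a₃ / algebraMap (↥L) F a₂ * algebraMap (↥L) F a₂ = _
    rw [div_mul_cancel₀ _ ha₂F]
  have hyK : (y : K) * T ^ 2 = T ^ 3 := congrArg Subtype.val hya
  have hyT : (y : K) = T := by
    have h2 : (T ^ 2 : K) ≠ 0 := pow_ne_zero 2 hT0
    calc (y : K) = (y : K) * T ^ 2 / T ^ 2 := by rw [mul_div_cancel_right₀ _ h2]
      _ = T ^ 3 / T ^ 2 := by rw [hyK]
      _ = T := by rw [pow_succ, mul_div_cancel_left₀ _ h2]
  exact hXL (hyT ▸ y.2)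

end Summit.ResolutionOfSingularities.ResolutionOfSingularities.Theorems
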